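import Literature.IUT.LogVolume.WildCubicCoordinates
import Literature.IUT.LogVolume.LogRadius
import HarnessLib

/-!
# The logarithm of the units of `K = ℚ₃(π)`, `π³ = 3`: `log₃(𝒪_K^×) ⊆ {a + bπ + cπ² : a ≡ b (mod 3)}`

Continuation of `WildCubicCoordinates.lean` (classical local arithmetic; no disputed mathematics).  With
`ψ = B.coord 0 − B.coord 1` (`ψ(a + bπ + cπ²) = a − b`) for a `ℚ₃`-basis `B = (1, π, π²)` of `K`:

* `exists_sign_isPrincipal` — every unit is `≡ ±1 (mod π)` (residue field `𝔽₃`);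
* `exists_pow_sub_norm_le` — every principal unit `y` satisfies `‖(1+π)^c − y‖ ≤ ‖π‖²` for some
  `c ∈ {0, 1, 2}`, i.e. `1 + 𝔪 = (1+π)^ℤ·(1 + 𝔪²)`;
* `norm_logSeries_le_of_norm_le` — `‖L(y')‖ ≤ ‖π‖²` when `‖1 − y'‖ ≤ ‖π‖²` (term of index `m = 3^s·t` has
  size `≤ ‖π‖^{2m}·3^s ≤ ‖π‖²`);
* `logSeries_one_add_pi` — `L(1+π) = π − π²/2 + 1 + R`, `‖R‖ ≤ ‖π‖²`: the cubic term `π³/3 = 1` of the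
  logarithmic series is a UNIT — the wild phenomenon `log₃(𝒪_K^×) ⊄ 𝔪_K`;
* **`norm_psi_unitLog_le`**, **`norm_psi_le_of_mem_logUnits`** — for every unit `u`,
  `‖ψ(log₃ u)‖ ≤ 1/3`: `log₃(𝒪_K^×) ⊆ ψ⁻¹(3ℤ₃)` (`log₃ = unitLog`, `log₃(𝒪_K^×) = logUnits K` of
  abc-iut-S1's `LocalUnitLog.lean`; in fact `log₃(𝒪_K^×) = ℤ₃(1+π) ⊕ 3ℤ₃ ⊕ ℤ₃π²`, of which only this
  upper bound is needed downstream).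

Consumer: `WildShellObstruction.lean`.  Proof-only file (theorems, no definitions).
[cite: NeukirchANT1999, Ch. II (5.5)] [cite: Mochizuki2012, IUTchIV Prop. 1.2 (i)–(ii) p. 10]
-/

noncomputable section

open Metric Set Filter Finset
open scoped Topology

namespace Literature.IUT.LogVolume

namespace WildCubic

variable {K : Type*} [NontriviallyNormedField K] [NormedAlgebra ℚ_[3] K] {π : K}

/-! ### Units are `≡ ±1 (mod π)`; principal units are `(1+π)^c·(1 + O(π²))` -/

/-- Residues of `3`-adic integers: `‖a‖ ≤ 1 ⇒ ‖a − n‖ < 1` for some `n ∈ {0, 1, 2}`.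
[cite: NeukirchANT1999, Ch. II (5.5)] -/
theorem exists_residue {a : ℚ_[3]} (ha : ‖a‖ ≤ 1) : ∃ n : ℕ, n < 3 ∧ ‖a - n‖ < 1 := by
  obtain ⟨n, hn, hmem⟩ := PadicInt.exists_mem_range (⟨a, ha⟩ : ℤ_[3])
  refine ⟨n, hn, ?_⟩
  rw [IsLocalRing.mem_maximalIdeal, PadicInt.mem_nonunits, PadicInt.norm_def, PadicInt.coe_sub,
    PadicInt.coe_natCast] at hmem
  exact hmem

/-- `(1 + π)² = 1 + 2π + π²` with the `ℚ₃`-scalar `2`. [cite: NeukirchANT1999, Ch. II (5.5)] -/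
theorem one_add_pi_sq : (1 + π) ^ 2 = 1 + (2 : ℚ_[3]) • π + π ^ 2 := by
  rw [Algebra.smul_def, map_ofNat]
  ring

section Units

variable [IsUltrametricDist K] (B : Module.Basis (Fin 3) ℚ_[3] K)

/-- **Units are `≡ ±1 (mod 𝔪)`** (residue field `𝔽₃`): for `‖u‖ = 1` there is `s = ±1` with `s·u` a
principal unit. [cite: NeukirchANT1999, Ch. II (5.5)] -/
theorem exists_sign_isPrincipal (hπ : π ^ 3 = 3) (hB0 : B 0 = 1) (hB1 : B 1 = π) (hB2 : B 2 = π ^ 2)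
    {u : K} (hu : ‖u‖ = 1) : ∃ s : K, (s = 1 ∨ s = -1) ∧ IsPrincipal (s * u) := by
  have hmax := norm_eq_max B hπ hB0 hB1 hB2 u
  rw [hu] at hmax
  -- the `π`- and `π²`-coordinates are integral
  have hb : ‖B.repr u 1‖ ≤ 1 := by
    refine padicNorm_le_one_of_mul_norm_pi_lt hπ (lt_of_le_of_ne ?_ ?_)
    · rw [hmax]; exact (le_max_left _ _).trans (le_max_right _ _)
    · by_cases h0 : B.repr u 1 = 0
      · rw [h0, norm_zero, zero_mul]; norm_num
      · have h := norm_smul_pi_pow_ne hπ h0 (one_ne_zero (α := ℚ_[3])) (i := 1) (j := 0)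
          (by norm_num) (by norm_num) (by norm_num)
        simpa using h
  have hc : ‖B.repr u 2‖ ≤ 1 := by
    refine padicNorm_le_one_of_mul_norm_pi_sq_lt hπ (lt_of_le_of_ne ?_ ?_)
    · rw [hmax]; exact (le_max_right _ _).trans (le_max_right _ _)
    · by_cases h0 : B.repr u 2 = 0
      · rw [h0, norm_zero, zero_mul]; norm_num
      · have h := norm_smul_pi_pow_ne hπ h0 (one_ne_zero (α := ℚ_[3])) (i := 2) (j := 0)
          (by norm_num) (by norm_num) (by norm_num)
        simpa using h
  -- hence the constant coordinate is a unit
  have ha : ‖B.repr u 0‖ = 1 := by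
    have hle : ‖B.repr u 0‖ ≤ 1 := by rw [hmax]; exact le_max_left _ _
    refine le_antisymm hle (le_of_not_gt fun hlt => ?_)
    have h1 : ‖B.repr u 1‖ * ‖π‖ < 1 := by
      calc ‖B.repr u 1‖ * ‖π‖ ≤ 1 * ‖π‖ := by gcongr
        _ < 1 := by rw [one_mul]; exact norm_pi_lt_one hπ
    have h2 : ‖B.repr u 2‖ * ‖π‖ ^ 2 < 1 := by
      calc ‖B.repr u 2‖ * ‖π‖ ^ 2 ≤ 1 * ‖π‖ ^ 2 := by gcongr
        _ < 1 := by rw [one_mul]; exact norm_pi_sq_lt_one hπ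
    have : max ‖B.repr u 0‖ (max (‖B.repr u 1‖ * ‖π‖) (‖B.repr u 2‖ * ‖π‖ ^ 2)) < 1 :=
      max_lt hlt (max_lt h1 h2)
    rw [← hmax] at this
    exact lt_irrefl _ this
  obtain ⟨n, hn, hres⟩ := exists_residue ha.le
  interval_cases n
  · -- residue `0` is impossible for a unit coordinate
    simp only [Nat.cast_zero, sub_zero] at hres
    exact absurd ha hres.ne
  · refine ⟨1, Or.inl rfl, ?_⟩
    rw [isPrincipal_iff, one_mul, norm_eq_max B hπ hB0 hB1 hB2 (1 - u), map_sub]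
    simp only [Finsupp.sub_apply, repr_one_zero B hB0, repr_one_one B hB0, repr_one_two B hB0,
      zero_sub, norm_neg]
    refine max_lt ?_ (max_lt ?_ ?_)
    · rw [norm_sub_rev]; simpa using hres
    · calc ‖B.repr u 1‖ * ‖π‖ ≤ 1 * ‖π‖ := by gcongr
        _ < 1 := by rw [one_mul]; exact norm_pi_lt_one hπ
    · calc ‖B.repr u 2‖ * ‖π‖ ^ 2 ≤ 1 * ‖π‖ ^ 2 := by gcongr
        _ < 1 := by rw [one_mul]; exact norm_pi_sq_lt_one hπ
  · refine ⟨-1, Or.inr rfl, ?_⟩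
    rw [isPrincipal_iff, neg_one_mul, sub_neg_eq_add, norm_eq_max B hπ hB0 hB1 hB2 (1 + u), map_add]
    simp only [Finsupp.add_apply, repr_one_zero B hB0, repr_one_one B hB0, repr_one_two B hB0,
      zero_add]
    refine max_lt ?_ (max_lt ?_ ?_)
    · have e : (1 : ℚ_[3]) + B.repr u 0 = (B.repr u 0 - 2) + 3 := by ring
      rw [e]
      refine (IsUltrametricDist.norm_add_le_max _ _).trans_lt (max_lt ?_ ?_)
      · simpa using hres
      · simpa using Padic.norm_p (p := 3) ▸ (by norm_num : ((3 : ℕ) : ℝ)⁻¹ < 1)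
    · calc ‖B.repr u 1‖ * ‖π‖ ≤ 1 * ‖π‖ := by gcongr
        _ < 1 := by rw [one_mul]; exact norm_pi_lt_one hπ
    · calc ‖B.repr u 2‖ * ‖π‖ ^ 2 ≤ 1 * ‖π‖ ^ 2 := by gcongr
        _ < 1 := by rw [one_mul]; exact norm_pi_sq_lt_one hπ

/-- **Principal units modulo `(1+π)`**: for `‖1 − y‖ < 1` there is `c ∈ {0, 1, 2}` with
`‖(1+π)^c − y‖ ≤ ‖π‖²`. [cite: NeukirchANT1999, Ch. II (5.5)] -/
theorem exists_pow_sub_norm_le (hπ : π ^ 3 = 3) (hB0 : B 0 = 1) (hB1 : B 1 = π) (hB2 : B 2 = π ^ 2)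
    {y : K} (hy : IsPrincipal y) : ∃ c : ℕ, c ≤ 2 ∧ ‖(1 + π) ^ c - y‖ ≤ ‖π‖ ^ 2 := by
  rw [isPrincipal_iff] at hy
  obtain ⟨h0, h1, h2⟩ := norm_repr_le B hπ hB0 hB1 hB2 (1 - y)
  simp only [map_sub, Finsupp.sub_apply, repr_one_zero B hB0, repr_one_one B hB0,
    repr_one_two B hB0, zero_sub, norm_neg] at h0 h1 h2
  have ha : ‖1 - B.repr y 0‖ ≤ 3⁻¹ := padicNorm_le_third_of_lt_one (h0.trans_lt hy)
  have hb : ‖B.repr y 1‖ ≤ 1 := padicNorm_le_one_of_mul_norm_pi_lt hπ (h1.trans_lt hy)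
  have hc : ‖B.repr y 2‖ ≤ 1 := padicNorm_le_one_of_mul_norm_pi_sq_lt hπ (h2.trans_lt hy)
  obtain ⟨n, hn, hres⟩ := exists_residue hb
  have hres' : ‖B.repr y 1 - n‖ ≤ 3⁻¹ := padicNorm_le_third_of_lt_one hres
  interval_cases n
  · refine ⟨0, by norm_num, ?_⟩
    rw [pow_zero]
    refine norm_le_sq_of_repr B hπ hB0 hB1 hB2 ?_ ?_ ?_ <;>
      simp only [map_sub, Finsupp.sub_apply, repr_one_zero B hB0, repr_one_one B hB0,
        repr_one_two B hB0, zero_sub, norm_neg]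
    · exact ha
    · simpa using hres'
    · exact hc
  · refine ⟨1, by norm_num, ?_⟩
    rw [pow_one]
    refine norm_le_sq_of_repr B hπ hB0 hB1 hB2 ?_ ?_ ?_ <;>
      simp only [map_sub, map_add, Finsupp.sub_apply, Finsupp.add_apply, repr_one_zero B hB0,
        repr_one_one B hB0, repr_one_two B hB0, repr_pi_zero B hB1, repr_pi_one B hB1,
        repr_pi_two B hB1, add_zero, zero_add, zero_sub, norm_neg]
    · exact ha
    · rw [norm_sub_rev]; simpa using hres'
    · exact hc
  · refine ⟨2, by norm_num, ?_⟩
    rw [one_add_pi_sq]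
    refine norm_le_sq_of_repr B hπ hB0 hB1 hB2 ?_ ?_ ?_ <;>
      simp only [map_sub, map_add, map_smul, Finsupp.sub_apply, Finsupp.add_apply,
        Finsupp.smul_apply, repr_one_zero B hB0, repr_one_one B hB0, repr_one_two B hB0,
        repr_pi_zero B hB1, repr_pi_one B hB1, repr_pi_two B hB1, repr_pi_sq_zero B hB2,
        repr_pi_sq_one B hB2, repr_pi_sq_two B hB2, smul_eq_mul, mul_zero, mul_one, add_zero,
        zero_add]
    · exact ha
    · rw [norm_sub_rev]; simpa using hres'
    · rw [sub_eq_add_neg]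
      refine (IsUltrametricDist.norm_add_le_max _ _).trans (max_le (by simp) ?_)
      rw [norm_neg]; exact hc

end Units

/-! ### Estimates for the logarithmic series -/

/-- `3s + 2 ≤ 2m` whenever `3^s ∣ m ≠ 0`. [cite: NeukirchANT1999, Ch. II (5.5)] -/
theorem three_mul_add_two_le_two_mul {m s : ℕ} (hm : m ≠ 0) (h : 3 ^ s ∣ m) : 3 * s + 2 ≤ 2 * m := by
  have hle : 3 ^ s ≤ m := Nat.le_of_dvd (Nat.pos_of_ne_zero hm) h
  have key : ∀ t : ℕ, 3 * t + 2 ≤ 2 * 3 ^ t := by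
    intro t
    induction t with
    | zero => norm_num
    | succ t ih => rw [pow_succ]; omega
  have := key s
  omega

/-- `3s + 3 ≤ m` whenever `3^s ∣ m` and `m ≥ 4`. [cite: NeukirchANT1999, Ch. II (5.5)] -/
theorem three_mul_add_three_le {m s : ℕ} (hm : 4 ≤ m) (h : 3 ^ s ∣ m) : 3 * s + 3 ≤ m := by
  have hle : 3 ^ s ≤ m := Nat.le_of_dvd (by omega) h
  rcases s with _ | _ | s
  · omega
  · rw [pow_one] at h
    omega
  · have key : ∀ t : ℕ, 3 * t + 9 ≤ 9 * 3 ^ t := by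
      intro t
      induction t with
      | zero => norm_num
      | succ t ih => rw [pow_succ]; omega
    have := key s
    rw [show 3 ^ (s + 2) = 9 * 3 ^ s by ring] at hle
    omega

/-- **Size of the terms of the logarithmic series**: `‖x^{n+1}/(n+1)‖ ≤ ‖x‖^{n+1}·3^{v₃(n+1)}`.
[cite: NeukirchANT1999, Ch. II (5.4)] -/
theorem norm_logTerm_le (x : K) (n : ℕ) :
    ‖-(x ^ (n + 1)) / (n + 1 : K)‖ ≤ ‖x‖ ^ (n + 1) * (3 : ℝ) ^ padicValNat 3 (n + 1) := by
  have hpos : (0 : ℝ) < (3 : ℝ) ^ (-(padicValNat 3 (n + 1) : ℤ)) := zpow_pos (by norm_num) _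
  have hle := zpow_neg_padicValNat_le_norm_natCast (K := K) (m := n + 1) (by omega)
  have hcast : ((n : K) + 1) = ((n + 1 : ℕ) : K) := by push_cast; ring
  rw [norm_div, norm_neg, norm_pow, hcast, div_le_iff₀ (hpos.trans_le hle)]
  calc ‖x‖ ^ (n + 1)
      = ‖x‖ ^ (n + 1) * (3 : ℝ) ^ padicValNat 3 (n + 1) * (3 : ℝ) ^ (-(padicValNat 3 (n + 1) : ℤ)) := by
        rw [zpow_neg, zpow_natCast, mul_assoc, mul_inv_cancel₀ (pow_ne_zero _ (by norm_num)), mul_one]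
    _ ≤ ‖x‖ ^ (n + 1) * (3 : ℝ) ^ padicValNat 3 (n + 1) * ‖((n + 1 : ℕ) : K)‖ := by gcongr

/-- **`L(1 + 𝔪²) ⊆ 𝔪²`**: `‖1 − y‖ ≤ ‖π‖² ⇒ ‖L(y)‖ ≤ ‖π‖²` (every term is that small: the term of index
`m = 3^s·t` has size `≤ ‖π‖^{2m}·3^s ≤ ‖π‖²`). [cite: NeukirchANT1999, Ch. II (5.5)] -/
theorem norm_logSeries_le_of_norm_le [IsUltrametricDist K] (hπ : π ^ 3 = 3) {y : K}
    (hy : ‖1 - y‖ ≤ ‖π‖ ^ 2) : ‖logSeries y‖ ≤ ‖π‖ ^ 2 := by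
  refine norm_logSeries_le (sq_nonneg _) fun n => (norm_logTerm_le (1 - y) n).trans ?_
  calc ‖1 - y‖ ^ (n + 1) * (3 : ℝ) ^ padicValNat 3 (n + 1)
      ≤ (‖π‖ ^ 2) ^ (n + 1) * (3 : ℝ) ^ padicValNat 3 (n + 1) := by gcongr
    _ = ‖π‖ ^ (2 * (n + 1)) * (3 : ℝ) ^ padicValNat 3 (n + 1) := by rw [pow_mul]
    _ ≤ ‖π‖ ^ 2 := norm_pi_pow_mul_three_pow_le hπ
        (three_mul_add_two_le_two_mul (by omega) pow_padicValNat_dvd)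

/-- **`L(1+π) = π − π²/2 + 1 + O(π²)`**: the cubic term `π³/3 = 1` is a unit, all terms of index `≥ 4`
have size `≤ ‖π‖²`. [cite: NeukirchANT1999, Ch. II (5.5)] -/
theorem logSeries_one_add_pi [IsUltrametricDist K] [CompleteSpace K] (hπ : π ^ 3 = 3) :
    ∃ R : K, ‖R‖ ≤ ‖π‖ ^ 2 ∧ logSeries (1 + π) = π + -(π ^ 2) / 2 + 1 + R := by
  have hneg : (1 : K) - (1 + π) = -π := by ring
  have hsum : HasSum (fun n : ℕ => -((1 - (1 + π)) ^ (n + 1)) / (n + 1 : K)) (logSeries (1 + π)) :=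
    hasSum_logSeries 3 (by rw [hneg, norm_neg]; exact norm_pi_lt_one hπ)
  have htail := (hasSum_nat_add_iff' 3).mpr hsum
  refine ⟨logSeries (1 + π) -
    ∑ i ∈ Finset.range 3, -((1 - (1 + π)) ^ (i + 1)) / (i + 1 : K), ?_, ?_⟩
  · rw [← htail.tsum_eq]
    refine IsUltrametricDist.norm_tsum_le_of_forall_le_of_nonneg (sq_nonneg _) fun n => ?_
    refine (norm_logTerm_le (1 - (1 + π)) (n + 3)).trans ?_
    rw [hneg, norm_neg]
    refine norm_pi_pow_mul_three_pow_le hπ ?_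
    have h := three_mul_add_three_le (m := n + 3 + 1) (by omega) (pow_padicValNat_dvd (p := 3))
    omega
  · have h3 : (3 : K) ≠ 0 := by
      intro h
      have h' := norm_three (K := K)
      rw [h, norm_zero] at h'
      norm_num at h'
    have hcube : (1 - (1 + π)) ^ 3 = -3 := by
      rw [hneg, neg_pow, hπ]; norm_num
    rw [Finset.sum_range_succ, Finset.sum_range_succ, Finset.sum_range_succ, Finset.sum_range_zero,
      zero_add, show (2 : ℕ) + 1 = 3 from rfl, hcube]
    have e2 : -(-3 : K) / ((2 : ℕ) + 1 : K) = 1 := by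
      rw [neg_neg, show ((2 : ℕ) : K) + 1 = 3 by norm_num, div_self h3]
    rw [e2, hneg]
    push_cast
    ring

section LogBounds

variable [IsUltrametricDist K] [CompleteSpace K] (B : Module.Basis (Fin 3) ℚ_[3] K)

/-- `‖ψ(L(1+π))‖ ≤ 1/3`: `ψ(π − π²/2 + 1) = −1 − 0 + 1 = 0` and the remainder lies in `𝔪²`.
[cite: NeukirchANT1999, Ch. II (5.5)] -/
theorem norm_psi_logSeries_one_add_pi_le (hπ : π ^ 3 = 3) (hB0 : B 0 = 1) (hB1 : B 1 = π)
    (hB2 : B 2 = π ^ 2) : ‖(B.coord 0 - B.coord 1) (logSeries (1 + π))‖ ≤ 3⁻¹ := by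
  obtain ⟨R, hR, hL⟩ := logSeries_one_add_pi hπ
  have hdiv : -(π ^ 2) / (2 : K) = (2 : ℚ_[3])⁻¹ • (-(π ^ 2)) := by
    rw [Algebra.smul_def, map_inv₀, map_ofNat, div_eq_inv_mul]
  rw [hL, map_add, map_add, map_add, hdiv, map_smul, map_neg, psi_one B hB0, psi_pi B hB1,
    psi_pi_sq B hB2, neg_zero, smul_zero, add_zero, neg_add_cancel, zero_add]
  exact norm_psi_le_of_norm_le B hπ hB0 hB1 hB2 hR

/-- **MAIN LOCAL ESTIMATE**: for every unit `u` of `K`, `‖ψ(log₃ u)‖ ≤ 1/3`, i.e.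
`log₃(𝒪_K^×) ⊆ {x : x₀ ≡ x₁ (mod 3ℤ₃)}`. Proof: `u ≡ ±1 (mod π)`, `log₃(±1) = 0`, so `log₃ u = L(y)` for
the principal unit `y = ±u = (1+π)^c·y'`, `‖1 − y'‖ ≤ ‖π‖²`; then `L(y) = c·L(1+π) + L(y')` and both
summands have `ψ`-value in `3ℤ₃`. [cite: NeukirchANT1999, Ch. II (5.5)] -/
theorem norm_psi_unitLog_le [ProperSpace K] (hπ : π ^ 3 = 3) (hB0 : B 0 = 1) (hB1 : B 1 = π)
    (hB2 : B 2 = π ^ 2) {u : K} (hu : ‖u‖ = 1) : ‖(B.coord 0 - B.coord 1) (unitLog u)‖ ≤ 3⁻¹ := by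
  obtain ⟨s, hs, hP⟩ := exists_sign_isPrincipal B hπ hB0 hB1 hB2 hu
  have hss : s * s = 1 := by rcases hs with rfl | rfl <;> norm_num
  have hs1 : ‖s‖ = 1 := by rcases hs with rfl | rfl <;> simp
  have hsu : ‖s * u‖ = 1 := by rw [norm_mul, hs1, hu, one_mul]
  have hlog : unitLog u = logSeries (s * u) := by
    have h1 : unitLog (s * (s * u)) = unitLog s + unitLog (s * u) := unitLog_mul 3 hs1 hsu
    rw [← mul_assoc, hss, one_mul] at h1
    rw [h1, unitLog_eq_zero_of_pow_eq_one 3 two_pos (by rw [pow_two, hss]), zero_add,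
      unitLog_of_isPrincipal 3 hP]
  obtain ⟨c, -, hle⟩ := exists_pow_sub_norm_le B hπ hB0 hB1 hB2 hP
  have hP1 : IsPrincipal (1 + π) := by
    rw [isPrincipal_iff, show (1 : K) - (1 + π) = -π by ring, norm_neg]
    exact norm_pi_lt_one hπ
  have hPw : IsPrincipal ((1 + π) ^ c) := hP1.pow c
  have hw1 : ‖(1 + π) ^ c‖ = 1 := hPw.norm_eq_one
  have hw0 : (1 + π) ^ c ≠ 0 := norm_pos_iff.mp (by rw [hw1]; norm_num)
  have hy'1 : ‖1 - ((1 + π) ^ c)⁻¹ * (s * u)‖ ≤ ‖π‖ ^ 2 := by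
    have e : 1 - ((1 + π) ^ c)⁻¹ * (s * u) = ((1 + π) ^ c)⁻¹ * ((1 + π) ^ c - s * u) := by
      rw [mul_sub, inv_mul_cancel₀ hw0]
    rw [e, norm_mul, norm_inv, hw1, inv_one, one_mul]
    exact hle
  have hPy' : IsPrincipal (((1 + π) ^ c)⁻¹ * (s * u)) :=
    lt_of_le_of_lt hy'1 (norm_pi_sq_lt_one hπ)
  have hdec : s * u = (1 + π) ^ c * (((1 + π) ^ c)⁻¹ * (s * u)) := by
    rw [mul_inv_cancel_left₀ hw0]
  have hL : logSeries (s * u) =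
      (c : ℚ_[3]) • logSeries (1 + π) + logSeries (((1 + π) ^ c)⁻¹ * (s * u)) := by
    rw [hdec, logSeries_mul 3 hPw hPy', logSeries_pow 3 hP1, ← hdec, Algebra.smul_def, map_natCast]
  rw [hlog, hL, map_add, map_smul]
  refine (IsUltrametricDist.norm_add_le_max _ _).trans (max_le ?_ ?_)
  · rw [norm_smul]
    have hc1 : ‖(c : ℚ_[3])‖ ≤ 1 := by
      have h := Padic.norm_int_le_one (p := 3) (c : ℤ)
      rwa [Int.cast_natCast] at h
    calc ‖(c : ℚ_[3])‖ * ‖(B.coord 0 - B.coord 1) (logSeries (1 + π))‖ ≤ 1 * 3⁻¹ := by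
          gcongr
          exact norm_psi_logSeries_one_add_pi_le B hπ hB0 hB1 hB2
      _ = 3⁻¹ := one_mul _
  · exact norm_psi_le_of_norm_le B hπ hB0 hB1 hB2 (norm_logSeries_le_of_norm_le hπ hy'1)

/-- **`log₃(𝒪_K^×) ⊆ ψ⁻¹(3ℤ₃)`**: for every `z ∈ log₃(𝒪_K^×)` (`logUnits K`, abc-iut-S1), `‖ψ(z)‖ ≤ 1/3`.
[cite: NeukirchANT1999, Ch. II (5.5)] -/
theorem norm_psi_le_of_mem_logUnits [ProperSpace K] (hπ : π ^ 3 = 3) (hB0 : B 0 = 1)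
    (hB1 : B 1 = π) (hB2 : B 2 = π ^ 2) {z : K} (hz : z ∈ logUnits K) :
    ‖(B.coord 0 - B.coord 1) z‖ ≤ 3⁻¹ := by
  obtain ⟨u, hu, rfl⟩ := mem_logUnits_iff.mp hz
  exact norm_psi_unitLog_le B hπ hB0 hB1 hB2 hu

end LogBounds

/-! ### `π` is a uniformizer, `e(K/ℚ₃) = 3`, and `3𝒪_K ⊆ log₃(𝒪_K^×)` ([IUTchIV] Prop. 1.2 (i), `a = 1`) -/

section Ramification

open Literature.NumberTheory.GaloisRepresentations.Ultrametric

variable [IsUltrametricDist K] (B : Module.Basis (Fin 3) ℚ_[3] K)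

omit [IsUltrametricDist K] in
/-- `‖a‖ = ‖π‖^{3·ord₃(a)}` for `a ∈ ℚ₃^×`. [cite: NeukirchANT1999, Ch. II (5.5)] -/
theorem padicNorm_eq_norm_pi_zpow (hπ : π ^ 3 = 3) {a : ℚ_[3]} (ha : a ≠ 0) :
    ‖a‖ = ‖π‖ ^ (3 * a.valuation) := by
  rw [Padic.norm_eq_zpow_neg_valuation ha, show ((3 : ℕ) : ℝ) = 3 by norm_num, zpow_mul,
    show ((3 : ℤ)) = ((3 : ℕ) : ℤ) by rfl, zpow_natCast, norm_pi_pow_three hπ, inv_zpow', zpow_neg]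

/-- **`π` is a (norm) uniformizer of `K`**: every nonzero absolute value is an integral power of `‖π‖`
(the value group is `‖π‖^ℤ = 3^{ℤ/3}`). [cite: NeukirchANT1999, Ch. II (5.5)] -/
theorem isUniformizer_pi (hπ : π ^ 3 = 3) (hB0 : B 0 = 1) (hB1 : B 1 = π) (hB2 : B 2 = π ^ 2) :
    IsUniformizer (Units.mk0 π (norm_pos_iff.mp (norm_pi_pos hπ))) := by
  have hπ0 : ‖π‖ ≠ 0 := (norm_pi_pos hπ).ne'
  refine ⟨by simpa using norm_pi_lt_one hπ, fun y => ?_⟩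
  have hy0 : ‖(y : K)‖ ≠ 0 := norm_ne_zero_iff.mpr y.ne_zero
  have h := norm_eq_max B hπ hB0 hB1 hB2 (y : K)
  simp only [Units.val_mk0]
  rcases max_choice ‖B.repr (y : K) 0‖
      (max (‖B.repr (y : K) 1‖ * ‖π‖) (‖B.repr (y : K) 2‖ * ‖π‖ ^ 2)) with hm | hm
  · rw [hm] at h
    have ha : B.repr (y : K) 0 ≠ 0 := fun h0 => by rw [h0, norm_zero] at h; exact hy0 h
    exact ⟨3 * (B.repr (y : K) 0).valuation, by rw [h, padicNorm_eq_norm_pi_zpow hπ ha]⟩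
  · rw [hm] at h
    rcases max_choice (‖B.repr (y : K) 1‖ * ‖π‖) (‖B.repr (y : K) 2‖ * ‖π‖ ^ 2) with hm' | hm'
    · rw [hm'] at h
      have hb : B.repr (y : K) 1 ≠ 0 := fun h0 => by
        rw [h0, norm_zero, zero_mul] at h; exact hy0 h
      refine ⟨3 * (B.repr (y : K) 1).valuation + 1, ?_⟩
      rw [h, padicNorm_eq_norm_pi_zpow hπ hb, zpow_add_one₀ hπ0]
    · rw [hm'] at h
      have hc : B.repr (y : K) 2 ≠ 0 := fun h0 => by
        rw [h0, norm_zero, zero_mul] at h; exact hy0 h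
      refine ⟨3 * (B.repr (y : K) 2).valuation + 2, ?_⟩
      rw [h, padicNorm_eq_norm_pi_zpow hπ hc, zpow_add₀ hπ0, zpow_ofNat]

/-- **`e(K/ℚ₃) = 3`**: the absolute ramification index of abc-iut-S1's `RamificationInvariants.lean`
evaluates to `3` (`‖3‖ = ‖π‖³`). [cite: Mochizuki2012, IUTchIV Prop. 1.2 (i) p. 10] -/
theorem absRamificationIdx_eq_three [ProperSpace K] (hπ : π ^ 3 = 3) (hB0 : B 0 = 1) (hB1 : B 1 = π)
    (hB2 : B 2 = π ^ 2) : absRamificationIdx 3 K = 3 := by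
  have h := norm_prime_eq_norm_pow 3 K (isUniformizer_pi B hπ hB0 hB1 hB2)
  simp only [Units.val_mk0, Nat.cast_ofNat] at h
  rw [norm_three, ← norm_pi_pow_three hπ] at h
  exact (pow_right_injective₀ (norm_pi_pos hπ) (norm_pi_lt_one hπ).ne h).symm

/-- **`3𝒪_K ⊆ log₃(𝒪_K^×)`** ([IUTchIV] Prop. 1.2 (i) `p^{a}·R ⊆ log_p(R^×)` with `a = ⌈e/(p−2)⌉/e = 1`,
abc-iut-S1's `pBall_logRadiusA_subset_logUnits`): `‖x‖ ≤ 1 ⇒ 3x ∈ log₃(𝒪_K^×)`.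
[cite: Mochizuki2012, IUTchIV Prop. 1.2 (i) p. 10] -/
theorem three_mul_mem_logUnits [ProperSpace K] (hπ : π ^ 3 = 3) (hB0 : B 0 = 1) (hB1 : B 1 = π)
    (hB2 : B 2 = π ^ 2) {x : K} (hx : ‖x‖ ≤ 1) : 3 * x ∈ logUnits K := by
  have h := pBall_logRadiusA_subset_logUnits 3 K
  have hA : logRadiusA 3 3 = 1 := by
    rw [logRadiusA, if_neg (by norm_num)]
    norm_num
  rw [absRamificationIdx_eq_three B hπ hB0 hB1 hB2, hA] at h
  apply h
  rw [mem_pBall_iff, norm_mul, norm_three, show ((3 : ℕ) : ℝ) = 3 by norm_num, Real.rpow_neg_one]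
  exact mul_le_of_le_one_right (by norm_num) hx

end Ramification

end WildCubic

end Literature.IUT.LogVolume

end
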